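import Mathlib.Analysis.Complex.Basic
import Literature.Geometry.Lorentzian.KerrSchild
import Literature.Geometry.Lorentzian.WeightedNorms
import HarnessLib

-- provenance: harness21/H21/H21/Statements/GR/Sweep2.lean @ f6fe9f0 (interim HEAD d8f2665); M5 mechanical rewrite
/-!
# Boundedness and decay for the Teukolsky equation on Kerr
(family `gr`, statement sweep 2: **gr.S27**; trunk G08 = T-LORENTZ, outline
`H21/Outlines/Lorentz.md` §4.10; namespace `Literature.GR`, glue in `Literature.Lorentz.Kerr` and
`Literature.Lorentz`)

Round 1 (`Sweep1.lean`, `BlackHoles.lean`) left **gr.S27** unstated for want of the spin-`±2`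
Teukolsky operator, spin-weighted regularity at the axis, and the DHR energy norms. This file
supplies these as routine coordinate glue on the existing ingoing Kerr–Schild exterior chart
`Kerr.exterior M a = {r > r₊} ⊆ E4` (`KerrSchild.lean`) and states gr.S27 in the same
*consequence form* that `BlackHoles.lean` uses for the scalar wave equation (gr.S24).

## Covered statement ids

* **gr.S27** — boundedness and decay for the Teukolsky equation of spin `s = ±2` on Kerr:
  `srtdc_teukolsky_boundedness_kerr`, `srtdc_teukolsky_integrated_decay_kerr`,
  `srtdc_teukolsky_polynomial_decay_kerr` (full subextremal range `|a| < M`;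
  Shlapentokh-Rothman–Teixeira da Costa, arXiv:2007.07211, Theorem A (p. 5) and
  arXiv:2302.08916, Theorem A (p. 3), precise form Thm. 5.1 (p. 46) and Cor. 5.1 (p. 47)),
  stated as **named facts** `def <name> : Prop` (deep published theorems, vendored as
  propositions and never asserted without proof), and the slowly rotating case
  `dhr_teukolsky_boundedness_kerr_small_a`, `dhr_teukolsky_integrated_decay_kerr_small_a`,
  `dhr_teukolsky_polynomial_decay_kerr_small_a` (Dafermos–Holzegel–Rodnianski, Ann. PDE 5
  (2019), Thm. 4.1 (p. 27 of arXiv:1711.07944); `a = 0`: Acta Math. 222 (2019)), the latter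
  *proved* from the named facts (taken as hypotheses) with `a₀ = 1`.

## Not covered

Nothing else was requested (gr.S27 was the only id of the family not yet elaborated). The
*linear stability of Schwarzschild/Kerr to gravitational perturbations* proper (DHR Acta
Math. 222 (2019), Thm. 1: decay of the full linearised metric to a linearised Kerr solution
after adding a pure gauge solution) is not stated: it needs the linearised Einstein equations
in double null gauge (linearised metric/Ricci/curvature components and the pure-gauge and
linearised-Kerr families), which the prelude does not have. The Teukolsky part stated here is
the gauge-invariant core of that theorem and is what the inventory text of gr.S27 names.

## Local glue (namespace `Literature.Lorentz`, `Literature.Lorentz.Kerr`)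

All glue is explicit coordinate algebra on `E4` (index `0 = t*`), no stubs:

* `sliceSobolevEnergy U f τ k p A = ∫_{y ∈ A, (τ,y) ∈ U} (1+‖y‖)^p ∑_{m ≤ k} ‖D^m f̃(τ,y)‖² dy`
  for vector-valued `f : U → G` (higher-order weighted analogue of `sliceEnergy`).
* Boyer–Lindquist quantities on the Kerr–Schild chart: `Kerr.delta` (`Δ = r² − 2Mr + a²`),
  `Kerr.axis`, `Kerr.axialRadius`, `Kerr.cosTheta` (`x₃/r`), `Kerr.sinTheta`
  (`ϖ/√(r²+a²)`), the BL coordinate fields `Kerr.blAxialVector = ∂_φ = x₁∂₂ − x₂∂₁` and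
  `Kerr.blRadialVector = ∂_r|_{t,θ,φ} = (2Mr/Δ)∂_{t*} + (a/Δ)∂_φ + ℓⁱ∂ᵢ` (from
  `t* = t + r_* − r`, `φ̃ = φ + r♯`, `x₁ + i x₂ = (r + ia) e^{iφ̃} sin θ`, `x₃ = r cos θ`, the
  chart in which `Kerr.nullCovector` is `dt* + dr`; consistency check:
  `g(∂_{t*}, ∂_φ) = −2Ha ϖ²/(r²+a²) = −2Mar sin²θ/ρ²` is the BL `g_{tφ}` with the same `a`).
* `Kerr.frameM = m = ∂_θ + (i/ sin θ) ∂_φ̃` (Kinnersley's `m` up to a smooth unit and a smooth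
  vector field), `Kerr.spinFrame s` (`m̄` for `s > 0`, `m` for `s ≤ 0`), and the
  **tensorisation** `Kerr.tensorise a s α = α · m_s ⊗ m_s : U → (Fin 4 → Fin 4 → ℂ)`, which is
  a smooth tensor field iff `α` is a smooth spin-`s`-weighted function (`s = ±2`); this is how
  regularity *at the axis* and non-degenerate energies of spin-weighted fields are expressed
  without spin-weighted function spaces.
* `Kerr.rescale M a s α = Δ^s (r²+a²)^{-max(s,0)} α` (DHR's horizon-regular `α̃^{[±2]}`),
  `Kerr.coordDeriv`, `Kerr.cdalembertian` (complex `□_g`), the Teukolsky operator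
  `Kerr.teukolskyOp M a s` (Teukolsky 1973, (4.7), in the form `ρ² □_g +` first order of DHR
  2019, §2.3), the admissible class `Kerr.IsAdmissibleTeukolskyField` (the tensorisation off
  the axis extends to a smooth tensor field `T` on the whole chart — this is smoothness of
  `α` as a spin-weighted function, with *no* vanishing condition on the axis —, Teukolsky off
  the axis, data of `T` compactly supported in the open slice `{t* = 0, r > r₊}`), the
  energies `Kerr.teukolskyEnergy`, and the sanity lemmas `frameM_of_mem_axis`,
  `tensorise_of_mem_axis` (the coordinate expressions are junk-zero on the axis, whence the
  extension `T`), `teukolskyOp_zero`, `isAdmissibleTeukolskyField_zero`,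
  `teukolskyEnergy_zero` (the class is nonempty, so the statements are not vacuous; they are
  not trivial either since `C < ⊤` is uniform in `α`).

The glue exceeds the nominal 40 lines per statement (about 120 lines of definitions for six
statements) but every piece is a one-line coordinate formula; `delta`, `cosTheta`,
`sinTheta`, `blRadialVector`, `frameM`, `tensorise`, `sliceSobolevEnergy` are promotion
candidates for `Prelude/Lorentz/{KerrSchild, WeightedNorms}`.

## Design choices

* **Consequence form, as for gr.S24.** The printed theorems bound DHR's weighted energies
  `𝔼_{Σ_τ}[α̃^{[±2]}], 𝔼[ψ̃^{[±2]}], 𝔼[P^{[±2]}]` (up to two null derivatives of `α̃`) and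
  Morawetz/`r^p` bulk integrals by the same quantities initially, with constants depending on
  `M, a` only, on a horizon-crossing foliation. We assert what follows robustly for the
  coordinate energies of the tensorised rescaled field through the Kerr–Schild leaves
  `{t* = τ} ∩ {r > r₊}`: (i) uniform boundedness of the *local* first-order energy on
  `{‖y‖ ≤ R}` by `C(M,a,R)` times a weighted `k`-th order initial energy (`k`, `p`
  existential: loss of derivatives and of polynomial weights, never vacuity — `C` is uniform
  in `α` and `τ`); (ii) integrated local energy decay; (iii) polynomial decay with a rate
  `q(M,a) > 0` uniform in `α`. Locality on the left and the existential weight `p` on the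
  right make the statements insensitive to the polynomial `r`-normalisation of `α̃` at
  infinity and to the choice of horizon-regular foliation; the powers of `Δ` in `Kerr.rescale`
  (which matter at `H⁺`) are DHR's.
* **Spin-weighted regularity via tensorisation** (see `Kerr.tensorise`): DHR define smooth
  spin-weighted functions analytically (§2.2.1, via the modified rotation fields `Z̃ᵢ`); we
  use the equivalent geometric definition (smooth section of `(T^{0,1}S²)^{⊗2}` resp.
  `(T^{1,0}S²)^{⊗2}` along the coordinate spheres, embedded in the trivial bundle
  `ℂ⁴ ⊗ ℂ⁴`), for which smoothness and energies are those of an honest vector-valued function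
  on the chart. Coordinate energies of `α` itself would be *wrong* (a smooth spin-`±2` function
  is discontinuous at the axis as a function, with infinite coordinate `H¹`-energy).
* **Full range first.** The subextremal theorems (SRTdC 2020/2023) are the primary statements,
  vendored as named facts `def … : Prop` (universally quantified over `M, a, s`); the DHR
  `|a| ≪ M` forms are proved from them as hypotheses (`a₀ = 1`,
  `Kerr.IsSubextremal M a ↔ |a| < M`), which documents their consistency.
* `s : ℤ` with the hypothesis `s = 2 ∨ s = -2`; the operator and the class make sense for all
  `s` (for `s = 0`, `teukolskyOp` is `ρ² □_g` and the class is that of gr.S24 tensorised by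
  `m ⊗ m`), but only `s = ±2` is asserted.
* Imports: `KerrSchild` (chart, `Kerr.metric`, `Kerr.Facts`; it imports `LeviCivita` for
  `PseudoRiemannianMetric.dalembertian`) and `WeightedNorms` (slice energies, Lebesgue measure
  on `E3`); the file no longer imports `BlackHoles.lean` (gr.S24), whose only use here was
  the elementary lemma `dalembertian_const`, re-proved below as a private auxiliary
  (`dalembertian_const_aux`; TODO(promotion): move to `LeviCivita`).
* **Standing hypotheses (named-fact regime of the prelude).** The Kerr metric is
  `Kerr.metric M a r₀` under the instance hypothesis `[Kerr.Facts]` (analyticity and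
  connectedness facts of the chart), and the wave operator `□_g` needs the Levi-Civita
  hypothesis `[(Kerr.metric M a r₊).HasLeviCivita]` (`LeviCivita.lean`); both are threaded as
  instance arguments through `Kerr.cdalembertian`, `Kerr.teukolskyOp`,
  `Kerr.IsAdmissibleTeukolskyField` and the statements, exactly as `Kerr.isRicciFlat` does.
  Mathlib has no Kerr geometry, null frames, spin-weighted functions or Teukolsky equation
  (`rg -i 'teukolsky|spin.weighted|newman.penrose' Mathlib` is empty); from Mathlib we use
  `fderiv`, `iteratedFDeriv`, `mfderiv`, `ContMDiff`, `lintegral`, `Function.extend`,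
  `Set.indicator`, `Metric.closedBall`, `Complex`, `star`, `zpow`.

## References

* S. A. Teukolsky, *Perturbations of a rotating black hole. I*, Astrophys. J. 185 (1973)
  635–647, (4.7); S. A. Teukolsky, W. H. Press, Astrophys. J. 193 (1974) 443, §II.
* W. Kinnersley, J. Math. Phys. 10 (1969) 1195; E. Newman, R. Penrose, J. Math. Phys. 7 (1966)
  863; R. Penrose, W. Rindler, *Spinors and space-time* I, CUP 1984, §4.12, §4.15;
  M. Eastwood, P. Tod, *Edth — a differential operator on the sphere*, Math. Proc. Camb. Phil.
  Soc. 92 (1982) 317–330.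
* M. Dafermos, G. Holzegel, I. Rodnianski, *Boundedness and decay for the Teukolsky equation
  on Kerr spacetimes I: the case `|a| ≪ M`*, Ann. PDE 5 (2019), Paper No. 2, §1–§4, main
  theorem Thm. 4.1 (§4.2; arXiv:1711.07944 p. 27) [DafermosHolzegelRodnianski2019].
* M. Dafermos, G. Holzegel, I. Rodnianski, *The linear stability of the Schwarzschild solution
  to gravitational perturbations*, Acta Math. 222 (2019) 1–214, Thms. 1–2 of the overview.
* Y. Shlapentokh-Rothman, R. Teixeira da Costa, *Boundedness and decay for the Teukolsky
  equation on Kerr in the full subextremal range `|a| < M`: frequency space analysis*,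
  arXiv:2007.07211, Theorem A (p. 5; the paper's own main result is the frequency-space
  Theorem 1/1A) [ShlapentokhrothmanCosta2020]; *physical space analysis*, arXiv:2302.08916,
  Theorem A (p. 3), Thm. 5.1 (Main result, p. 46: energy flux boundedness, integrated local
  energy decay, higher-order estimates, `s ∈ {0, ±1, ±2}`, `|a| ≤ a₀ < M`,
  `C = C(a₀, M, |s|, δ, p)`) and Cor. 5.1 (Decay, p. 47) [ShlapentokhrothmanCosta2023].
* M. Dafermos, I. Rodnianski, *Lectures on black holes and linear waves*, arXiv:0811.0354,
  §4–§5.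
-/

noncomputable section

open Set TopologicalSpace MeasureTheory
open scoped ContDiff ENNReal Manifold

/-! ### Two elementary auxiliary facts on the d'Alembertian -/

namespace Literature.Geometry.Lorentzian.PseudoRiemannianMetric

variable {E : Type*} [NormedAddCommGroup E] [NormedSpace ℝ E] {H : Type*} [TopologicalSpace H]
  {I : ModelWithCorners ℝ E H} {M : Type*} [TopologicalSpace M] [ChartedSpace H M]
  [IsManifold I ∞ M] {n : ℕ∞ω}

/-- The Hessian of a constant function vanishes (`Hess c (X, Y) = X(Y c) − (∇_X Y) c = 0`).
Auxiliary copy (private) of the lemma of `BlackHoles.lean`, pending its promotion to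
`LeviCivita.lean`. O'Neill 1983, Ch. 3, Def. 3.48. [cite: ONeill1983, Ch. 3  Def. 3.48] -/
private theorem hessian_const_aux [FiniteDimensional ℝ E] [CompleteSpace E] [Fact (1 ≤ n)]
    (g : PseudoRiemannianMetric I n E (TangentSpace I : M → Type _)) [g.HasLeviCivita]
    (c : ℝ) (x : M) : g.hessian (fun _ ↦ c) x = 0 := by
  have haux : ∀ X Y : Π x : M, TangentSpace I x, g.hessianAux (fun _ ↦ c) X Y x = 0 := by
    intro X Y
    simp [PseudoRiemannianMetric.hessianAux, mvfderiv_const]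
  unfold PseudoRiemannianMetric.hessian
  have hex : ∃ B : LinearMap.BilinForm ℝ (TangentSpace I x), ∀ X₀ Y₀ : TangentSpace I x,
      B X₀ Y₀ =
        g.hessianAux (fun _ ↦ c) (FiberBundle.extend E X₀) (FiberBundle.extend E Y₀) x :=
    ⟨0, fun _ _ ↦ by simp [haux]⟩
  rw [dif_pos hex]
  ext X₀ Y₀
  simpa [haux] using hex.choose_spec X₀ Y₀

/-- Constants solve the wave equation: `□_g c = tr_g Hess c = 0`. Auxiliary copy (private) of
the lemma of `BlackHoles.lean`. O'Neill 1983, Ch. 3, Def. 3.50. [cite: ONeill1983, Ch. 3  Def. 3.50] -/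
private theorem dalembertian_const_aux [FiniteDimensional ℝ E] [CompleteSpace E]
    [Fact (1 ≤ n)] (g : PseudoRiemannianMetric I n E (TangentSpace I : M → Type _))
    [g.HasLeviCivita] (c : ℝ) (x : M) : g.dalembertian (fun _ ↦ c) x = 0 := by
  simp [PseudoRiemannianMetric.dalembertian, g.hessian_const_aux, PseudoRiemannianMetric.trace]

end Literature.Geometry.Lorentzian.PseudoRiemannianMetric

/-! ### Glue: higher-order weighted coordinate energies of vector-valued fields -/

namespace Literature.Geometry.Lorentzian

variable {G : Type*} [NormedAddCommGroup G] [NormedSpace ℝ G]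

/-- The **`k`-th order weighted coordinate energy** of a field `f : U → G` (`U : Opens E4`,
`G` a real normed space) through the part `{t* = τ₀} ∩ {y ∈ A}` of a Kerr–Schild slice:
`∫_{y ∈ A, (τ₀, y) ∈ U} (1 + ‖y‖)^p ∑_{m ≤ k} ‖D^m f̃ (τ₀, y)‖² dy ∈ [0, ∞]`, where
`f̃ = Function.extend Subtype.val f 0` is the extension by zero and `D^m` the (spacetime)
iterated Fréchet derivative (`iteratedFDeriv`), which on the open set `U` only sees `f`.
For `G = ℝ`, `k = 1`, `p = 0`, `A = univ` this dominates `sliceEnergy` (it also contains the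
zeroth-order term). Vector-valued, higher-order analogue of `sliceEnergy` /
`localSliceEnergy` / `weightedSliceEnergy` of `WeightedNorms`. *Weight convention:* the same
weight `(1 + ‖y‖)^p` multiplies all derivative orders `m ≤ k`, unlike
`WeightedNorms.weightedSobolevSeminorm`, which uses the order-dependent weight
`(1 + ‖x‖)^{2(δ+m)}`; here `p` is only ever quantified existentially, so the two conventions
give equivalent statements, but they must not be confused. Dafermos–Rodnianski,
arXiv:0811.0354, §4.1–4.3; Dafermos–Holzegel–Rodnianski, Ann. PDE 5 (2019), §5.2 (weighted
higher-order energies of spin-weighted fields through `{t* = τ}`). [cite: arXiv08110354] -/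
def sliceSobolevEnergy (U : Opens E4) (f : U → G) (τ₀ : ℝ) (k : ℕ) (p : ℝ) (A : Set E3) :
    ℝ≥0∞ :=
  ∫⁻ y in A, {y | E4.ofTimeSpace τ₀ y ∈ U}.indicator
    (fun y ↦ ENNReal.ofReal ((1 + ‖y‖) ^ p * ∑ m ∈ Finset.range (k + 1),
      ‖iteratedFDeriv ℝ m (Function.extend Subtype.val f (0 : E4 → G)) (E4.ofTimeSpace τ₀ y)‖
        ^ 2)) y

/-- The weighted coordinate energy is monotone in the region of integration
(Dafermos–Rodnianski, arXiv:0811.0354, §4). [cite: arXiv08110354] -/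
theorem sliceSobolevEnergy_mono (U : Opens E4) (f : U → G) (τ₀ : ℝ) (k : ℕ) (p : ℝ)
    {A B : Set E3} (h : A ⊆ B) :
    sliceSobolevEnergy U f τ₀ k p A ≤ sliceSobolevEnergy U f τ₀ k p B :=
  lintegral_mono_set h

/-- The weighted coordinate energy of the zero field vanishes (DR arXiv:0811.0354, §4). [cite: arXiv08110354] -/
@[simp]
theorem sliceSobolevEnergy_zero (U : Opens E4) (τ₀ : ℝ) (k : ℕ) (p : ℝ) (A : Set E3) :
    sliceSobolevEnergy U (fun _ ↦ (0 : G)) τ₀ k p A = 0 := by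
  have h0 : Function.extend (Subtype.val : U → E4) (fun _ ↦ (0 : G)) (0 : E4 → G) = 0 := by
    funext x
    classical
    rw [Function.extend_def]
    split_ifs <;> rfl
  simp [sliceSobolevEnergy, h0]

end Literature.Geometry.Lorentzian

/-! ### Glue: Boyer–Lindquist quantities on the Kerr–Schild chart -/

namespace Literature.Geometry.Lorentzian.Kerr

/-- The Kerr horizon function `Δ(r) = r² − 2Mr + a²` (roots `r_±`). Boyer–Lindquist 1967;
Teukolsky, ApJ 185 (1973), (4.3); O'Neill 1995, Ch. 2, §2.1. [cite: BoyerLindquist1967] -/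
def delta (M a r : ℝ) : ℝ := r ^ 2 - 2 * M * r + a ^ 2

/-- The **axis** `{x₁ = x₂ = 0}` of the Kerr–Schild chart (`sin θ = 0`), where the frame
`Kerr.frameM` degenerates and spin-weighted quantities are read off through `Kerr.tensorise`.
O'Neill 1995, Ch. 2, §2.1; Dafermos–Holzegel–Rodnianski, Ann. PDE 5 (2019), §2.2.1. [cite: ONeill1995, Ch. 2  §2.1] -/
def axis : Set E4 := {x | x 1 = 0 ∧ x 2 = 0}

/-- The cylindrical radius `ϖ = √(x₁² + x₂²) = √(r² + a²) sin θ` of the Kerr–Schild chart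
(`x₁ + i x₂ = (r + i a) e^{iφ̃} sin θ`; Kerr, PRL 11 (1963); Visser arXiv:0706.0622, (36)). [cite: arXiv07060622] -/
def axialRadius (x : E4) : ℝ := √(x 1 ^ 2 + x 2 ^ 2)

/-- `cos θ = x₃ / r` for the Boyer–Lindquist / Kerr–Schild polar angle (`x₃ = r cos θ`).
Kerr, PRL 11 (1963); Visser arXiv:0706.0622, (36). Junk value at `r = 0` (never used). [cite: arXiv07060622] -/
def cosTheta (a : ℝ) (x : E4) : ℝ := x 3 / radius a x

/-- `sin θ = ϖ / √(r² + a²)` for the Boyer–Lindquist / Kerr–Schild polar angle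
(`x₁ + i x₂ = (r + i a) e^{iφ̃} sin θ`). Visser arXiv:0706.0622, (36). It vanishes exactly on
`Kerr.axis`. [cite: arXiv07060622] -/
def sinTheta (a : ℝ) (x : E4) : ℝ := axialRadius x / √(radius a x ^ 2 + a ^ 2)

/-- The Boyer–Lindquist axial coordinate vector `∂_φ = ∂_{φ̃} = x₁ ∂₂ − x₂ ∂₁` at `x` (the
components of `Kerr.axialField`, as a vector of `E4`). O'Neill 1995, Ch. 2, §2.2. [cite: ONeill1995, Ch. 2  §2.2] -/
def blAxialVector (x : E4) : E4 := (x 1) • E4.basisVector 2 - (x 2) • E4.basisVector 1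

/-- The **Boyer–Lindquist radial coordinate vector `∂_r|_{t,θ,φ}`** expressed in the ingoing
Kerr–Schild Cartesian chart: with `t* = t + r_*(r) − r`, `φ̃ = φ + r♯(r)`,
`dr_* = (r²+a²)/Δ dr`, `dr♯ = (a/Δ) dr`, one has
`∂_r|_{BL} = (2Mr/Δ) ∂_{t*} + (a/Δ) ∂_{φ̃} + ℓ¹ ∂₁ + ℓ² ∂₂ + ℓ³ ∂₃`, where
`(ℓ¹, ℓ², ℓ³) = ∂_r (x₁, x₂, x₃)|_{θ,φ̃}` are the spatial components of the Kerr–Schild null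
covector `Kerr.nullCovectorFun`. Singular at `Δ = 0` (the horizons), smooth on the exterior.
Teukolsky, ApJ 185 (1973), §IV; Misner–Thorne–Wheeler, Box 33.2; Dafermos–Rodnianski,
arXiv:0811.0354, §5.1. [cite: arXiv08110354] -/
def blRadialVector (M a : ℝ) (x : E4) : E4 :=
  (2 * M * radius a x / delta M a (radius a x)) • E4.basisVector 0 +
    (a / delta M a (radius a x)) • blAxialVector x +
      ∑ i : Fin 3, nullCovectorFun a x i.succ • E4.basisVector i.succ

/-- The complex frame vector **`m = ∂_θ + (i / sin θ) ∂_φ̃`** tangent to the coordinate spheres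
`{t*, r = const}`, in Kerr–Schild Cartesian components:
`∂_θ = cot θ (x₁ ∂₁ + x₂ ∂₂) − r sin θ ∂₃`, `(1/sin θ) ∂_φ̃ = (1/sin θ)(x₁ ∂₂ − x₂ ∂₁)`. Up to
the smooth non-vanishing factor `1/(√2 (r + i a cos θ))` and the smooth vector field
`i a sin θ ∂_t`, this is the Kinnersley vector `m` of the algebraically special null frame of
Kerr, whose spin-weight convention (`η ↦ e^{isψ} η` under `m ↦ e^{iψ} m`) is Teukolsky's.
On the axis `Kerr.axis` (`sin θ = 0`) every component is a division by zero, so by Lean's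
`x / 0 = 0` convention `frameM a x` is *literally the zero vector* there
(`frameM_of_mem_axis`); this junk value is never used (the axis is excluded pointwise in
`Kerr.IsAdmissibleTeukolskyField` and has measure zero in the energies).
Kinnersley, J. Math. Phys. 10 (1969) 1195;
Teukolsky, ApJ 185 (1973), (4.4); Newman–Penrose, J. Math. Phys. 7 (1966) 863. [folklore] -/
def frameM (a : ℝ) (x : E4) : Fin 4 → ℂ :=
  ![0,
    (cosTheta a x / sinTheta a x * x 1 : ℝ) - Complex.I * (x 2 / sinTheta a x : ℝ),
    (cosTheta a x / sinTheta a x * x 2 : ℝ) + Complex.I * (x 1 / sinTheta a x : ℝ),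
    (-(radius a x * sinTheta a x) : ℝ)]

/-- The frame vector carrying spin weight `-s/|s|`: `m̄` for `s > 0` and `m` for `s ≤ 0`, so that
`α · (spinFrame s ⊗ spinFrame s)` is frame-independent for `α` of spin weight `s = ±2`.
Newman–Penrose, J. Math. Phys. 7 (1966) 863; Penrose–Rindler, *Spinors and space-time* I
(1984), §4.12. [folklore] -/
def spinFrame (a : ℝ) (s : ℤ) (x : E4) : Fin 4 → ℂ :=
  if 0 < s then star (frameM a x) else frameM a x

variable {U : Opens E4}

/-- **Tensorisation of a spin-weighted scalar.** For `α : U → ℂ` of spin weight `s = +2`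
(resp. `−2`) the field of complex `2`-tensors `x ↦ α(x) m̄(x) ⊗ m̄(x)` (resp.
`α(x) m(x) ⊗ m(x)`), in Cartesian components `Fin 4 → Fin 4 → ℂ`. This is invariant under
frame rotations `m ↦ e^{iψ} m`, and `α` is a *smooth spin-`s`-weighted function* in the sense
of Dafermos–Holzegel–Rodnianski, Ann. PDE 5 (2019), §2.2.1 (equivalently: a smooth section of
the spin-`s` line bundle over the spheres, smoothly in `(t*, r)`) iff the restriction of
`tensorise a s α` to the complement of the axis *extends* to a smooth tensor field across the
axis — the standard identification of spin-`±2` scalars with complex symmetric horizontal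
tensors of type `(0,2)`/`(2,0)` (Penrose–Rindler I (1984), §4.12, §4.15; Eastwood–Tod,
Math. Proc. Camb. Phil. Soc. 92 (1982) 317). **Junk value on the axis:** since `frameM` is
literally `0` on `Kerr.axis`, so is `tensorise a s α` (`tensorise_of_mem_axis`), whereas the
genuine tensor `α m_s ⊗ m_s` has in general a *non-zero* limit there (e.g. the azimuthal
modes `m' = ±2`); hence smoothness across the axis is expressed through an extension `T` in
`Kerr.IsAdmissibleTeukolskyField`, never through `tensorise` itself. The junk value is
irrelevant for the energies (`sliceSobolevEnergy`): the axis meets every slice in a set of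
measure zero and `iteratedFDeriv` at a point off the (closed) axis only sees the honest
values. Coordinate energies of `tensorise a s α` are non-degenerate energies of the section
`α` (locally uniformly comparable to DHR's `|∂_{t*} α|² + |∂_r α|² + |∇̸^{[s]} α|² + |α|²`). [folklore] -/
def tensorise (a : ℝ) (s : ℤ) (α : U → ℂ) : U → Fin 4 → Fin 4 → ℂ :=
  fun x μ ν ↦ α x * spinFrame a s x.1 μ * spinFrame a s x.1 ν

/-- `sin θ` vanishes on the axis (Visser arXiv:0706.0622, (36)). [cite: arXiv07060622] -/
theorem sinTheta_of_mem_axis (a : ℝ) {x : E4} (hx : x ∈ axis) : sinTheta a x = 0 := by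
  obtain ⟨h1, h2⟩ := hx
  simp [sinTheta, axialRadius, h1, h2]

/-- Sanity lemma: the coordinate expression `frameM` is *literally zero* on the axis (Lean's
`x / 0 = 0`), documenting the junk value discussed in `frameM` and `tensorise`
(Newman–Penrose, J. Math. Phys. 7 (1966) 863: the true frame vector `m` does not vanish). [folklore] -/
theorem frameM_of_mem_axis (a : ℝ) {x : E4} (hx : x ∈ axis) : frameM a x = 0 := by
  have hs : sinTheta a x = 0 := sinTheta_of_mem_axis a hx
  obtain ⟨h1, h2⟩ := hx
  funext μ
  fin_cases μ <;> simp [frameM, h1, h2, hs]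

/-- Sanity lemma: the tensorisation is junk-zero on the axis for *every* `α`, which is why
regularity across the axis is phrased via an extension in `IsAdmissibleTeukolskyField`
(Penrose–Rindler I (1984), §4.15). [folklore] -/
theorem tensorise_of_mem_axis (a : ℝ) (s : ℤ) (α : U → ℂ) (x : U) (hx : x.1 ∈ axis) :
    tensorise a s α x = 0 := by
  funext μ ν
  simp [tensorise, spinFrame, frameM_of_mem_axis a hx]

/-- The **horizon-regular rescaling** `α̃^{[s]} = Δ^{s} (r² + a²)^{-max(s,0)} α^{[s]}` of a
spin-`s` Teukolsky field: `α̃^{[+2]} = Δ² (r²+a²)^{-2} α^{[+2]}`, `α̃^{[-2]} = Δ^{-2} α^{[-2]}`,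
the quantities which extend regularly and non-degenerately to the future event horizon `H⁺`
(the Kinnersley frame being singular there) and whose weighted energies are bounded.
Dafermos–Holzegel–Rodnianski, Ann. PDE 5 (2019), §1.1 and §2.4; Teukolsky–Press, ApJ 193
(1974), §II (`R_s ∼ Δ^{-s}` at `H⁺`). Polynomial `r`-weights at infinity are immaterial for the
local / weight-existential statements below. [folklore] -/
def rescale (M a : ℝ) (s : ℤ) (α : U → ℂ) : U → ℂ :=
  fun x ↦ ((delta M a (radius a x.1)) ^ s * (radius a x.1 ^ 2 + a ^ 2) ^ (-max s 0) : ℝ) • α x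

/-- The coordinate directional derivative `v(α)(x) = D α̃ (x) v ∈ ℂ` of (the extension by zero
`α̃ : E4 → ℂ` of) `α : U → ℂ` at `x : E4` along `v : E4` (honest on the open set `U`; the
same device as `coordEnergyDensity`). Dafermos–Rodnianski, arXiv:0811.0354, §4.1. [cite: arXiv08110354] -/
def coordDeriv (α : U → ℂ) (x : E4) (v : E4) : ℂ :=
  fderiv ℝ (Function.extend Subtype.val α (0 : E4 → ℂ)) x v

/-- The scalar wave operator `□_g` of the (smooth) Kerr metric `g_{M,a}` on the exterior
`{r > r₊}` applied to a complex function, `□_g α = □_g (re α) + i □_g (im α)`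
(`PseudoRiemannianMetric.dalembertian`). Teukolsky, ApJ 185 (1973), (4.7) with `s = 0`;
Dafermos–Holzegel–Rodnianski, Ann. PDE 5 (2019), §2.3. [folklore] -/
def cdalembertian [Facts] (M a : ℝ) [(metric M a (rPlus M a)).HasLeviCivita] (α : exterior M a → ℂ)
    (x : exterior M a) : ℂ :=
  ((metric M a (rPlus M a)).toPseudoRiemannianMetric.dalembertian (fun y ↦ (α y).re) x : ℂ)
    + Complex.I *
      ((metric M a (rPlus M a)).toPseudoRiemannianMetric.dalembertian (fun y ↦ (α y).im) x
        : ℂ)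

/-- The **Teukolsky operator of spin `s`** on the Kerr exterior `{r > r₊}`, in the form
"`ρ² □_g` + first order" (Teukolsky's master operator (4.7) is `−𝔗^{[s]}`; here
`ρ² = r² + a² cos² θ`, `Δ = r² − 2Mr + a²`, and `∂_t, ∂_r, ∂_φ` are the Boyer–Lindquist
coordinate fields `∂_{t*}`, `Kerr.blRadialVector`, `Kerr.blAxialVector`):
`𝔗^{[s]} α = ρ² □_g α + 2s (r − M) ∂_r α + 2s (a (r − M)/Δ + i cos θ / sin² θ) ∂_φ α`
`  + 2s (M (r² − a²)/Δ − r − i a cos θ) ∂_t α + (s − s² cot² θ) α`.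
The **Teukolsky equation** is `𝔗^{[s]} α^{[s]} = 0`; for `s = +2` (resp. `−2`) it is satisfied
by the extreme Newman–Penrose curvature components `Ψ₀` (resp. `(r − i a cos θ)⁴ Ψ₄`) of
linearised gravity in the Kinnersley frame, and for `s = 0` it is the wave equation. Junk on
the axis (`sin θ = 0`), where the equation is imposed by continuity (through the smooth
extension `T` of the tensorised field in `Kerr.IsAdmissibleTeukolskyField`).
Teukolsky, ApJ 185 (1973), (4.7); Dafermos–Holzegel–Rodnianski, Ann. PDE 5 (2019), §2.3. [folklore] -/
def teukolskyOp [Facts] (M a : ℝ) [(metric M a (rPlus M a)).HasLeviCivita] (s : ℤ)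
    (α : exterior M a → ℂ) (x : exterior M a) : ℂ :=
  ((radius a x.1 ^ 2 + a ^ 2 * cosTheta a x.1 ^ 2 : ℝ) : ℂ) * cdalembertian M a α x +
    2 * (s : ℂ) * ((radius a x.1 - M : ℝ) : ℂ) * coordDeriv α x.1 (blRadialVector M a x.1) +
    2 * (s : ℂ) * (((a * (radius a x.1 - M) / delta M a (radius a x.1) : ℝ) : ℂ) +
        Complex.I * ((cosTheta a x.1 / sinTheta a x.1 ^ 2 : ℝ) : ℂ)) *
      coordDeriv α x.1 (blAxialVector x.1) +
    2 * (s : ℂ) * (((M * (radius a x.1 ^ 2 - a ^ 2) / delta M a (radius a x.1) - radius a x.1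
          : ℝ) : ℂ) - Complex.I * ((a * cosTheta a x.1 : ℝ) : ℂ)) *
      coordDeriv α x.1 (E4.basisVector 0) +
    ((s : ℂ) - (s : ℂ) ^ 2 * ((cosTheta a x.1 ^ 2 / sinTheta a x.1 ^ 2 : ℝ) : ℂ)) * α x

/-- **Admissible spin-`s` Teukolsky fields on the Kerr exterior** (`s = ±2` intended):
`α : Kerr.exterior M a → ℂ` is a smooth spin-`s`-weighted function, i.e. there is a `C^∞`
tensor field `T` on the *whole* exterior chart (axis included) which agrees with the
tensorisation `α m̄ ⊗ m̄` / `α m ⊗ m` off the axis (the value of `Kerr.tensorise` *on* the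
axis being junk `0`, see there; `T` is the genuine tensor, uniquely determined by continuity
since the complement of the axis is dense); the Cauchy data of `T` on the Kerr–Schild slice
`{t* = 0} ∩ {r > r₊}` are compactly supported in the open slice: outside a compact `K`, `T`
and its full differential vanish on the slice (data supported away from `H⁺` and from
infinity, so that all of DHR's weighted higher-order initial energies are finite); and `α`
solves the Teukolsky equation `𝔗^{[s]} α = 0` off the axis (hence everywhere as a
spin-weighted identity, by continuity of `T`). This is the class of *all* smooth spin-`s`
solutions with compactly supported data, including the modes that do not vanish on the axis.
Dafermos–Holzegel–Rodnianski, Ann. PDE 5 (2019), §2.2–2.4 and Thm. 4.1 (hypotheses);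
Shlapentokh-Rothman–Teixeira da Costa, arXiv:2302.08916, §1 and Def. 3.1.1. [cite: ShlapentokhrothmanCosta2023, §1] -/
def IsAdmissibleTeukolskyField [Facts] (M a : ℝ) [(metric M a (rPlus M a)).HasLeviCivita] (s : ℤ)
    (α : exterior M a → ℂ) : Prop :=
  (∃ T : exterior M a → Fin 4 → Fin 4 → ℂ,
      ContMDiff 𝓘(ℝ, E4) 𝓘(ℝ, Fin 4 → Fin 4 → ℂ) ∞ T ∧
        (∀ x : exterior M a, x.1 ∉ axis → T x = tensorise a s α x) ∧
        ∃ K : Set (exterior M a), IsCompact K ∧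
          ∀ x : exterior M a, (x : E4) 0 = 0 → x ∉ K →
            T x = 0 ∧ mfderiv 𝓘(ℝ, E4) 𝓘(ℝ, Fin 4 → Fin 4 → ℂ) T x = 0) ∧
    ∀ x : exterior M a, x.1 ∉ axis → teukolskyOp M a s α x = 0

/-- The **weighted `k`-th order energy of the rescaled, tensorised Teukolsky field**
`α̃^{[s]} m_s ⊗ m_s` through `{t* = τ} ∩ {r > r₊} ∩ {y ∈ A}` with weight `(1 + ‖y‖)^p`
(`sliceSobolevEnergy` of `tensorise a s (rescale M a s α)`): the H21 stand-in for DHR's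
energies `𝔼_{Σ_τ}[𝔡^k α̃^{[±2]}]` (Ann. PDE 5 (2019), §5.2), to which it is locally uniformly
comparable on `{r₊ < r, ‖y‖ ≤ R}` (the Kerr–Schild leaves being uniformly spacelike and
horizon-regular, cf. gr.S24). The junk value `0` of `tensorise` on the axis does not affect
this quantity: the axis `{y₁ = y₂ = 0}` is Lebesgue-null in every slice, and at points off the
closed axis `iteratedFDeriv` only sees the honest values, which for an admissible field are
those of its smooth extension `T` (rescaled by the smooth factor `Δ^s (r²+a²)^{-max(s,0)}`). [folklore] -/
def teukolskyEnergy (M a : ℝ) (s : ℤ) (α : exterior M a → ℂ) (τ : ℝ) (k : ℕ) (p : ℝ)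
    (A : Set E3) : ℝ≥0∞ :=
  sliceSobolevEnergy (exterior M a) (tensorise a s (rescale M a s α)) τ k p A

/-- The tensorisation of the zero field is zero (Penrose–Rindler I (1984), §4.12). [folklore] -/
@[simp]
theorem tensorise_zero (a : ℝ) (s : ℤ) : tensorise a s (fun _ : U ↦ (0 : ℂ)) = fun _ ↦ 0 := by
  funext x μ ν
  simp [tensorise]

/-- The rescaling of the zero field is zero (DHR, Ann. PDE 5 (2019), §2.4). [folklore] -/
@[simp]
theorem rescale_zero (M a : ℝ) (s : ℤ) : rescale M a s (fun _ : U ↦ (0 : ℂ)) = fun _ ↦ 0 := by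
  funext x
  simp [rescale]

/-- The Teukolsky operator annihilates the zero field (Teukolsky, ApJ 185 (1973), (4.7)). [folklore] -/
theorem teukolskyOp_zero [Facts] (M a : ℝ) [(metric M a (rPlus M a)).HasLeviCivita] (s : ℤ)
    (x : exterior M a) : teukolskyOp M a s (fun _ ↦ 0) x = 0 := by
  have h0 : Function.extend (Subtype.val : exterior M a → E4) (fun _ ↦ (0 : ℂ)) (0 : E4 → ℂ)
      = 0 := by
    funext y
    classical
    rw [Function.extend_def]
    split_ifs <;> rfl
  simp [teukolskyOp, cdalembertian, coordDeriv, h0,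
    PseudoRiemannianMetric.dalembertian_const_aux]

/-- The zero field is an admissible spin-`s` Teukolsky field (the class is non-empty;
DHR, Ann. PDE 5 (2019), §4). [folklore] -/
theorem isAdmissibleTeukolskyField_zero [Facts] (M a : ℝ)
    [(metric M a (rPlus M a)).HasLeviCivita]
    (s : ℤ) : IsAdmissibleTeukolskyField M a s (fun _ ↦ 0) := by
  refine ⟨⟨fun _ ↦ 0, contMDiff_const, fun x _ ↦ ?_, ∅, isCompact_empty, fun x _ _ ↦
    ⟨rfl, mfderiv_const⟩⟩, fun x _ ↦ teukolskyOp_zero M a s x⟩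
  rw [tensorise_zero]

/-- The energies of the zero field vanish (DHR, Ann. PDE 5 (2019), §5.2). [folklore] -/
@[simp]
theorem teukolskyEnergy_zero (M a : ℝ) (s : ℤ) (τ : ℝ) (k : ℕ) (p : ℝ) (A : Set E3) :
    teukolskyEnergy M a s (fun _ ↦ 0) τ k p A = 0 := by
  simp [teukolskyEnergy]

end Literature.Geometry.Lorentzian.Kerr

namespace Literature.Geometry.Lorentzian


/-! ### gr.S27: the full subextremal range `|a| < M` (Shlapentokh-Rothman–Teixeira da Costa)

The three statements below are **named facts** (`def … : Prop`): deep published theorems,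
vendored as propositions and consumed as hypotheses (`(h : srtdc_teukolsky_boundedness_kerr)`),
never asserted without proof. -/

/-- **gr.S27** (energy boundedness for the Teukolsky equation on subextremal Kerr; named fact).
Source: Shlapentokh-Rothman–Teixeira da Costa, *Boundedness and decay for the Teukolsky
equation on Kerr in the full subextremal range `|a| < M`: physical space analysis*,
arXiv:2302.08916, Theorem A (p. 3: for `s ∈ {0, ±1, ±2}`, `M > 0`, `|a| < M`, general
solutions of the Teukolsky equation arising from sufficiently regular data "have uniformly
bounded energy fluxes through a suitable spacelike foliation of the black hole exterior,
through `H⁺`, and through `I⁺`, in terms of an energy flux of initial data at the same level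
of regularity", satisfy integrated local energy decay with loss of derivatives at trapping,
similar higher-order statements, and decay at an inverse polynomial rate), made precise as
Thm. 5.1 (Main result, p. 46; constants `C = C(a₀, M, |s|, δ, p)` for `|a| ≤ a₀ < M`) and
Cor. 5.1 (p. 47); the frequency-space half is arXiv:2007.07211, Theorem A (p. 5) / Thm. 1.
For `|a| ≪ M`: Dafermos–Holzegel–Rodnianski, Ann. PDE 5 (2019), Thm. 4.1.
**Lean statement (consequence form, H21 stand-in energies; standing hypotheses `[Kerr.Facts]`
and `[(Kerr.metric M a r₊).HasLeviCivita]` of the prelude).** For all `M, a` with `|a| < M`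
and `s = ±2`: there are a number of derivatives `k` and a weight exponent `p` such that for
every coordinate radius `R` there is `C = C(M, a, R) < ∞` with: for every smooth spin-`s`
solution `α^{[s]}` of the Teukolsky equation on the Kerr exterior `{r > r₊}` with data
compactly supported in the open slice `{t* = 0, r > r₊}` (`Kerr.IsAdmissibleTeukolskyField`)
and every `τ ≥ 0`, the (first-order, non-degenerate) coordinate energy of the horizon-regular
rescaled tensorised field `α̃^{[s]} = Δ^{s}(r²+a²)^{-max(s,0)} α^{[s]}` through
`{t* = τ} ∩ {r > r₊} ∩ {‖y‖ ≤ R}` is at most `C` times the `(1+‖y‖)^p`-weighted `k`-th order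
energy of `α̃^{[s]}` through `{t* = 0}`. This is *not* the printed inequality (which bounds
the paper's weighted energies `𝔼_p[Φ^{[s]}](τ)`, `𝔼[φ̃_k^{[s]}](τ)` on a hyperboloidal
foliation by the same quantities initially, without loss of derivatives) but a consequence
form: local in `r` on the left, loss of derivatives and of polynomial weights on the right
(`k`, `p` existential, `C` uniform in `α` and `τ`); `{t* ≥ 0, r > r₊}` lies in the future
Cauchy development of the slice, so `α` is determined there by its data.
[cite: ShlapentokhrothmanCosta2023, Theorem A p3; Thm 5.1 p46] -/
def srtdc_teukolsky_boundedness_kerr [Kerr.Facts] : Prop :=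
  ∀ (M a : ℝ) [(Kerr.metric M a (Kerr.rPlus M a)).HasLeviCivita], Kerr.IsSubextremal M a →
    ∀ s : ℤ, (s = 2 ∨ s = -2) →
      ∃ (k : ℕ) (p : ℝ), ∀ R : ℝ, ∃ C : ℝ≥0∞, C < ⊤ ∧
        ∀ α : Kerr.exterior M a → ℂ, Kerr.IsAdmissibleTeukolskyField M a s α →
          ∀ τ : ℝ, 0 ≤ τ →
            Kerr.teukolskyEnergy M a s α τ 1 0 (Metric.closedBall 0 R) ≤
              C * Kerr.teukolskyEnergy M a s α 0 k p univ

/-- **gr.S27** (integrated local energy decay for the Teukolsky equation on subextremal Kerr;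
named fact). Source: Shlapentokh-Rothman–Teixeira da Costa, arXiv:2302.08916, Theorem A
(p. 3, second item: "a suitable version of integrated local energy decay with loss of
derivatives at trapping") and Thm. 5.1 (p. 46–47, item "Integrated local energy decay":
`𝕀^{deg,J}_{-δ,p}[Φ^{[s]}](0,τ) + … ≤ C 𝔼_p[Φ^{[s]}](0) + C ∑_k 𝔼_p^{|s|-k}[φ̃_k^{[s]}](0)`,
`C = C(a₀, M, |s|, δ, p)`); frequency-space half arXiv:2007.07211, Thm. 1; for `|a| ≪ M`
Dafermos–Holzegel–Rodnianski, Ann. PDE 5 (2019), Thm. 4.1.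
**Lean statement (consequence form, standing hypotheses as in
`srtdc_teukolsky_boundedness_kerr`).** For all `|a| < M` and `s = ±2` there are `k`, `p`
such that for every `R` there is `C = C(M, a, R) < ∞` with: for every admissible spin-`s`
Teukolsky field `α^{[s]}`, the local coordinate energy of `α̃^{[s]}` through
`{t* = τ} ∩ {r > r₊} ∩ {‖y‖ ≤ R}` is integrable in `τ ∈ (0, ∞)` with integral at most `C`
times the weighted `k`-th order initial energy (Morawetz / integrated local energy decay
estimate; the loss of derivatives `k > 1` due to trapping is genuine, the locality in `r` and
the existential weights are the consequence form).
[cite: ShlapentokhrothmanCosta2023, Theorem A p3; Thm 5.1 p46-47] -/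
def srtdc_teukolsky_integrated_decay_kerr [Kerr.Facts] : Prop :=
  ∀ (M a : ℝ) [(Kerr.metric M a (Kerr.rPlus M a)).HasLeviCivita], Kerr.IsSubextremal M a →
    ∀ s : ℤ, (s = 2 ∨ s = -2) →
      ∃ (k : ℕ) (p : ℝ), ∀ R : ℝ, ∃ C : ℝ≥0∞, C < ⊤ ∧
        ∀ α : Kerr.exterior M a → ℂ, Kerr.IsAdmissibleTeukolskyField M a s α →
          ∫⁻ τ in Ioi (0 : ℝ), Kerr.teukolskyEnergy M a s α τ 1 0 (Metric.closedBall 0 R) ≤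
            C * Kerr.teukolskyEnergy M a s α 0 k p univ

/-- **gr.S27** (polynomial energy decay for the Teukolsky equation on subextremal Kerr; named
fact). Source: Shlapentokh-Rothman–Teixeira da Costa, arXiv:2302.08916, Theorem A (p. 3:
solutions "decay at a suitable inverse polynomial rate, with estimates which depend only on
`M, |a|, s` and a suitable, higher order, initial data quantity") and Cor. 5.1 (Decay, p. 47:
`sup_{Σ_τ} (|Φ^{[s]}|² + |φ̃_k^{[s]}|²)^{1/2} ≤ C 𝔻_{2,4} τ^{-1/2}` for `s ≤ 0`, resp.
`≤ C 𝔻_{2-η,4} τ^{-1/2-η/2}` for `s > 0`, `τ > 1`, `C = C(a₀, M, |s|, η)`), obtained from the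
`r^p`-weighted hierarchy of Thm. 5.1; for `|a| ≪ M` Dafermos–Holzegel–Rodnianski, Ann. PDE 5
(2019), Thm. 4.1 (item 4, polynomial decay of the energy, Thm. 11.1).
**Lean statement (consequence form, standing hypotheses as in
`srtdc_teukolsky_boundedness_kerr`).** For all `|a| < M` and `s = ±2` there are a rate
`q = q(M, a) > 0`, `k` and `p` such that for every `R` there is `C = C(M, a, R) < ∞` with:
for every admissible spin-`s` Teukolsky field `α^{[s]}` and every `τ ≥ 1`, the local
coordinate energy of `α̃^{[s]}` through `{t* = τ} ∩ {r > r₊} ∩ {‖y‖ ≤ R}` is at most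
`C τ^{-q}` times the weighted `k`-th order initial energy (in print the rates are explicit;
here `q` is existential but uniform in `α`).
[cite: ShlapentokhrothmanCosta2023, Theorem A p3; Cor 5.1 p47] -/
def srtdc_teukolsky_polynomial_decay_kerr [Kerr.Facts] : Prop :=
  ∀ (M a : ℝ) [(Kerr.metric M a (Kerr.rPlus M a)).HasLeviCivita], Kerr.IsSubextremal M a →
    ∀ s : ℤ, (s = 2 ∨ s = -2) →
      ∃ q : ℝ, 0 < q ∧ ∃ (k : ℕ) (p : ℝ), ∀ R : ℝ, ∃ C : ℝ≥0∞, C < ⊤ ∧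
        ∀ α : Kerr.exterior M a → ℂ, Kerr.IsAdmissibleTeukolskyField M a s α →
          ∀ τ : ℝ, 1 ≤ τ →
            Kerr.teukolskyEnergy M a s α τ 1 0 (Metric.closedBall 0 R) ≤
              C * ENNReal.ofReal (τ ^ (-q)) * Kerr.teukolskyEnergy M a s α 0 k p univ

/-! ### gr.S27: the slowly rotating case `|a| ≪ M` (Dafermos–Holzegel–Rodnianski) -/

/-- **gr.S27** (boundedness for the Teukolsky equation on slowly rotating Kerr;
Dafermos–Holzegel–Rodnianski, *Boundedness and decay for the Teukolsky equation on Kerr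
spacetimes I: the case `|a| ≪ M`*, Ann. PDE 5 (2019), Thm. 4.1 (§4.2, statement 2:
boundedness of the non-degenerate energies of `α̃^{[±2]}`, `ψ̃^{[±2]}`, `P^{[±2]}` for
`|a| ≤ a₀ ≪ M`); the Schwarzschild case is part of Dafermos–Holzegel–Rodnianski, *The
linear stability of the Schwarzschild solution to gravitational perturbations*, Acta Math.
222 (2019), Thm. 2). There is `a₀ > 0` such that for `M > 0`, `|a| < a₀ M` and `s = ±2` the
boundedness statement of `srtdc_teukolsky_boundedness_kerr` holds. Proved here from the full
subextremal named fact, taken as hypothesis `h` (`a₀ = 1`).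
[cite: DafermosHolzegelRodnianski2019, Thm 4.1] -/
theorem dhr_teukolsky_boundedness_kerr_small_a [Kerr.Facts]
    (h : srtdc_teukolsky_boundedness_kerr) :
    ∃ a₀ : ℝ, 0 < a₀ ∧ ∀ (M a : ℝ) [(Kerr.metric M a (Kerr.rPlus M a)).HasLeviCivita],
      0 < M → |a| < a₀ * M → ∀ s : ℤ, (s = 2 ∨ s = -2) →
      ∃ (k : ℕ) (p : ℝ), ∀ R : ℝ, ∃ C : ℝ≥0∞, C < ⊤ ∧
        ∀ α : Kerr.exterior M a → ℂ, Kerr.IsAdmissibleTeukolskyField M a s α →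
          ∀ τ : ℝ, 0 ≤ τ →
            Kerr.teukolskyEnergy M a s α τ 1 0 (Metric.closedBall 0 R) ≤
              C * Kerr.teukolskyEnergy M a s α 0 k p univ :=
  ⟨1, one_pos, fun M a _ _ ha s hs ↦ h M a (by simpa [Kerr.IsSubextremal] using ha) s hs⟩

/-- **gr.S27** (integrated local energy decay for the Teukolsky equation on slowly rotating
Kerr; Dafermos–Holzegel–Rodnianski, Ann. PDE 5 (2019), Thm. 4.1 (§4.2, statement 1 /
Thm. 9.1 and the red-shifted Thm. 10.1: integrated local energy decay); Acta Math. 222 (2019),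
Thm. 2 for `a = 0`). There is `a₀ > 0` such that for `M > 0`, `|a| < a₀ M` and `s = ±2` the
integrated decay statement of `srtdc_teukolsky_integrated_decay_kerr` holds. Proved from the
full subextremal named fact, taken as hypothesis `h` (`a₀ = 1`).
[cite: DafermosHolzegelRodnianski2019, Thm 4.1] -/
theorem dhr_teukolsky_integrated_decay_kerr_small_a [Kerr.Facts]
    (h : srtdc_teukolsky_integrated_decay_kerr) :
    ∃ a₀ : ℝ, 0 < a₀ ∧ ∀ (M a : ℝ) [(Kerr.metric M a (Kerr.rPlus M a)).HasLeviCivita],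
      0 < M → |a| < a₀ * M → ∀ s : ℤ, (s = 2 ∨ s = -2) →
      ∃ (k : ℕ) (p : ℝ), ∀ R : ℝ, ∃ C : ℝ≥0∞, C < ⊤ ∧
        ∀ α : Kerr.exterior M a → ℂ, Kerr.IsAdmissibleTeukolskyField M a s α →
          ∫⁻ τ in Ioi (0 : ℝ), Kerr.teukolskyEnergy M a s α τ 1 0 (Metric.closedBall 0 R) ≤
            C * Kerr.teukolskyEnergy M a s α 0 k p univ :=
  ⟨1, one_pos, fun M a _ _ ha s hs ↦ h M a (by simpa [Kerr.IsSubextremal] using ha) s hs⟩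

/-- **gr.S27** (polynomial decay for the Teukolsky equation on slowly rotating Kerr;
Dafermos–Holzegel–Rodnianski, Ann. PDE 5 (2019), Thm. 4.1 (§4.2, statement 4: polynomial
decay of the energy via the `r^p`-weighted hierarchy, Thm. 11.1); Acta Math. 222 (2019),
Thm. 2 for `a = 0`). There is `a₀ > 0` such that for `M > 0`, `|a| < a₀ M` and `s = ±2` the
polynomial decay statement of `srtdc_teukolsky_polynomial_decay_kerr` holds. Proved from the
full subextremal named fact, taken as hypothesis `h` (`a₀ = 1`).
[cite: DafermosHolzegelRodnianski2019, Thm 4.1] -/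
theorem dhr_teukolsky_polynomial_decay_kerr_small_a [Kerr.Facts]
    (h : srtdc_teukolsky_polynomial_decay_kerr) :
    ∃ a₀ : ℝ, 0 < a₀ ∧ ∀ (M a : ℝ) [(Kerr.metric M a (Kerr.rPlus M a)).HasLeviCivita],
      0 < M → |a| < a₀ * M → ∀ s : ℤ, (s = 2 ∨ s = -2) →
      ∃ q : ℝ, 0 < q ∧ ∃ (k : ℕ) (p : ℝ), ∀ R : ℝ, ∃ C : ℝ≥0∞, C < ⊤ ∧
        ∀ α : Kerr.exterior M a → ℂ, Kerr.IsAdmissibleTeukolskyField M a s α →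
          ∀ τ : ℝ, 1 ≤ τ →
            Kerr.teukolskyEnergy M a s α τ 1 0 (Metric.closedBall 0 R) ≤
              C * ENNReal.ofReal (τ ^ (-q)) * Kerr.teukolskyEnergy M a s α 0 k p univ :=
  ⟨1, one_pos, fun M a _ _ ha s hs ↦ h M a (by simpa [Kerr.IsSubextremal] using ha) s hs⟩

end Literature.Geometry.Lorentzian

end
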